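import Summits.ABC.IUTFork.Cor312GenuineKLocalType
import Literature.IUT.LogVolume.SubThetaFieldRamificationFifteen
import HarnessLib

/-!
# [IUTchIII] Cor. 3.12, branch C / R-W window table — the LOCAL-TYPE LEMMA at `λ_k = 1/2 + 2/7^k` for EVEN `k`:
# the Legendre curve is MULTIPLICATIVE at `7` over `ℚ` itself and every fibre point `x₀ | 7` of a genuine Θ-volume datum over
# `(λ_k, l)` has `¬ 7 ∣ e(K_{x₀}/ℚ_7)` and `e(K_{x₀}/ℚ_7) ∣ 15·l` («k-parity exact type»)

PROOF-ONLY support file (D-0012; 0 definitions, 0 `Prop` facts, no instance) of the abc-iut cell (R-W «WINDOW Θ-SIDE INEQUALITY», lane P−,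
seat abc-iut-w4-d087 gen 6, CLAIM «W:HEX:k-even» — the «k-parity / exact Tate type» row of abc-iut-w5-d163's HANDOFF 2026-08-26T18:13Z; plan g9
GO 18:42:10Z). TAKES NO SIDE on [IUTchIII] Cor. 3.12 (S. Mochizuki, *Inter-universal Teichmüller theory III*, RIMS manuscript, Cor. 3.12
p. 173–174) or on any author: classical algebraic number theory on the cell's typed Θ-volume data.

CONTEXT. The refutation engines of the hull-level clause S_H at the HEX data (abc-iut-w5-d163 `GenuineK.…_of_ramBound` p458036, abc-iut-W-neg-2
`GenuineK.…_of_ramification_le` p458737 / `…_sharp` p462041) read ONE number: a bound `E` on `e(K_{x₀}/ℚ_7)` at every place over `7`.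
abc-iut-W-neg-1's LOCAL-TYPE LEMMA gives `E = 60·l` (p459442) and, via cyclic tame inertia, the exact Tate type `E = 30·l` (p461051/p461700),
valid for EVERY `k`. For EVEN `k` the factor `2` disappears: `ord_7 λ_k = ord_7(λ_k − 1) = −k` is EVEN, so (i) the Legendre curve
`y² = x(x−1)(x−λ_k)` is MULTIPLICATIVE at `7` over `ℚ` (rescale by `d = 7^{−k/2} ∈ ℚ`; Silverman VII.5.4 (c) Case 3, this seat's
`legendre_hasMultiplicativeReductionAt_of_one_lt_valuation_of_valuation_sq_eq`) — no quadratic twist — and (ii) inertia at `7` fixes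
`√−1`, `√λ_k`, `√(λ_k − 1)`; hence `e(w|7) ∣ 15` for every place `w | 7` of every sub-Θ field (this seat's
`Cor22.ramificationIdx_subThetaField_dvd_fifteen`) and `e(K_x/ℚ_7) ∣ 15·l`:

* §1 `LamSevenEven.valuation_lamSeven` / `…_sub_one` — `|λ_k|_7 = |λ_k − 1|_7 = exp(k)` (`ord_7 = −k`);
  `LamSevenEven.legendre_lamSeven_hasMultiplicativeReductionAt` — for EVEN `k ≥ 1` the Legendre curve of `λ_k` is multiplicative at the place
  of `ℚ` over `7`;
* §2 **`Conditional.GenuineK.localType_lamSeven_fifteen`** — `k ≥ 1` EVEN, `l ≥ 11`, EVERY genuine Θ-volume datum `T` over `(ratPoint λ_k, l)`,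
  EVERY `x₀ | 7`: **`¬ 7 ∣ e(K_{x₀}/ℚ_7) ∧ e(K_{x₀}/ℚ_7) ∣ 15·l`**; `…absRamificationIdx_kOf_le_fifteen_mul_lamSeven` — hence `e ≤ 15·l`, the
  hypothesis `hloc` of the engines with `E := 15·l` (consumed in `Conditional/HexDepthLocalTypeFifteen`).

HONEST FRAMING: bookkeeping over OUR typed objects; nothing here bears on the printed inequality of [IUTchIII] Cor. 3.12 or on the number-level
`Cor22.Cor312AtDatum`; typed ≠ proved; instantiated ≠ endorsed. [cite: Mochizuki2012, IUTchI Ex. 3.2 (iv) p. 71; IUTchIV Prop. 1.8 (vi)–(vii) p. 19, Thm. 1.10 Steps (ii)–(iii) p. 24–26, Cor. 2.2 (ii) proof (P5) p. 46]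
[cite: SilvermanAEC2009, proof of Prop. VII.5.4(c), Case 3] [cite: SilvermanATAEC1994, V.4–V.5 and Exercise 5.13 (b)]
[claim: Mochizuki2012, status: disputed] for every IUT quotation.
-/

noncomputable section

open NumberField IsDedekindDomain

namespace Summit.ABC.IUTFork.Conditional

open Thm311 Thm311.Real Cor312 Cor312Prov Literature.IUT.LogVolume Literature.IUT.HodgeTheaters
  Literature.IUT.LogThetaLattice Literature.NumberTheory.NumberFields Literature.NumberTheory.DiophantineGeometry.GenEll
  Literature.NumberTheory.DiophantineGeometry Literature.NumberTheory.EllipticCurves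

/-! ## §1. `λ_k = 1/2 + 2/7^k` at the place of `ℚ` over `7`: `|λ_k|_7 = |λ_k − 1|_7 = exp(k)`; multiplicative for even `k` -/

namespace LamSevenEven

/-- `|7|_v = exp(−1)` at the place `v` of `ℚ` over `7` (`v = (7)`, Mathlib `intValuation_singleton`). [folklore] -/
theorem valuation_seven (v : HeightOneSpectrum (𝓞 ℚ)) (hv : Rat.HeightOneSpectrum.natGenerator v = 7) :
    v.valuation ℚ (7 : ℚ) = WithZero.exp (-1 : ℤ) := by
  have hp0 : (Rat.HeightOneSpectrum.natGenerator v : 𝓞 ℚ) ≠ 0 := by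
    exact_mod_cast (Rat.HeightOneSpectrum.prime_natGenerator v).ne_zero
  have hval : v.valuation ℚ (algebraMap (𝓞 ℚ) ℚ (Rat.HeightOneSpectrum.natGenerator v : 𝓞 ℚ)) =
      WithZero.exp (-1 : ℤ) := by
    rw [HeightOneSpectrum.valuation_of_algebraMap]
    exact HeightOneSpectrum.intValuation_singleton _ hp0 (UniformABCConjecture.asIdeal_eq_span_natGenerator v)
  rw [map_natCast, hv] at hval
  exact_mod_cast hval

/-- `|n|_v = 1` at the place over `7` for `7 ∤ n`. [folklore] -/
theorem valuation_natCast_eq_one (v : HeightOneSpectrum (𝓞 ℚ)) (hv : Rat.HeightOneSpectrum.natGenerator v = 7) {n : ℕ}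
    (hn : ¬ 7 ∣ n) : v.valuation ℚ (n : ℚ) = 1 :=
  (UniformABCConjecture.valuation_natCast_eq_one_iff v n).2 (by rw [hv]; exact hn)

/-- `|7^k|_v = exp(−k)`, i.e. `(|7^m|_v)⁻¹ = exp(m)`. [folklore] -/
theorem valuation_seven_pow (v : HeightOneSpectrum (𝓞 ℚ)) (hv : Rat.HeightOneSpectrum.natGenerator v = 7) (m : ℕ) :
    v.valuation ℚ ((7 : ℚ) ^ m) = (WithZero.exp (m : ℤ))⁻¹ := by
  rw [map_pow, valuation_seven v hv, ← WithZero.exp_nsmul, ← WithZero.exp_neg]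
  congr 1
  simp

/-- **`|λ_k|_7 = exp(k)`** (`ord_7 λ_k = −k`): `λ_k = (7^k + 4)/(2·7^k)` with `7 ∤ 7^k + 4`. [cite: Mochizuki2012, IUTchIV Cor 2.2 (ii) proof (P5) p.46] -/
theorem valuation_lamSeven (v : HeightOneSpectrum (𝓞 ℚ)) (hv : Rat.HeightOneSpectrum.natGenerator v = 7) {k : ℕ} (hk : 1 ≤ k) :
    v.valuation ℚ ((2 : ℚ)⁻¹ + 2 / 7 ^ k) = WithZero.exp (k : ℤ) := by
  have h7 : (7 : ℚ) ^ k ≠ 0 := pow_ne_zero _ (by norm_num)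
  have hlam : (2 : ℚ)⁻¹ + 2 / 7 ^ k = ((7 ^ k + 4 : ℕ) : ℚ) / (2 * (7 : ℚ) ^ k) := by
    push_cast
    field_simp
    ring
  have hnum : ¬ 7 ∣ 7 ^ k + 4 := fun h => by
    have : 7 ∣ 4 := (Nat.dvd_add_right (dvd_pow_self 7 (by omega : k ≠ 0))).1 h
    omega
  have h2 : v.valuation ℚ (2 : ℚ) = 1 := by exact_mod_cast valuation_natCast_eq_one v hv (n := 2) (by omega)
  rw [hlam, map_div₀, map_mul, valuation_natCast_eq_one v hv hnum, h2, one_mul, valuation_seven_pow v hv k, one_div, inv_inv]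

/-- **`|λ_k − 1|_7 = exp(k)`** (`ord_7(λ_k − 1) = −k`): `λ_k − 1 = −(7^k − 4)/(2·7^k)` with `7 ∤ 7^k − 4`. [cite: Mochizuki2012, IUTchIV Cor 2.2 (ii) proof (P5) p.46] -/
theorem valuation_lamSeven_sub_one (v : HeightOneSpectrum (𝓞 ℚ)) (hv : Rat.HeightOneSpectrum.natGenerator v = 7) {k : ℕ}
    (hk : 1 ≤ k) : v.valuation ℚ ((2 : ℚ)⁻¹ + 2 / 7 ^ k - 1) = WithZero.exp (k : ℤ) := by
  have h7 : (7 : ℚ) ^ k ≠ 0 := pow_ne_zero _ (by norm_num)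
  have hle : 4 ≤ 7 ^ k := le_trans (by norm_num) (Nat.pow_le_pow_right (by norm_num : 1 ≤ 7) hk)
  have hlam : (2 : ℚ)⁻¹ + 2 / 7 ^ k - 1 = -(((7 ^ k - 4 : ℕ) : ℚ) / (2 * (7 : ℚ) ^ k)) := by
    rw [Nat.cast_sub hle]
    push_cast
    field_simp
    ring
  have hnum : ¬ 7 ∣ 7 ^ k - 4 := fun h => by
    have : 7 ∣ 7 ^ k - (7 ^ k - 4) := Nat.dvd_sub (dvd_pow_self 7 (by omega : k ≠ 0)) h
    rw [Nat.sub_sub_self hle] at this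
    omega
  have h2 : v.valuation ℚ (2 : ℚ) = 1 := by exact_mod_cast valuation_natCast_eq_one v hv (n := 2) (by omega)
  rw [hlam, Valuation.map_neg, map_div₀, map_mul, valuation_natCast_eq_one v hv hnum, h2, one_mul, valuation_seven_pow v hv k,
    one_div, inv_inv]

/-- `λ_k`, `λ_k − 1` both have EVEN `7`-order when `k` is even: `|λ_k|_7 = |λ_k − 1|_7 = exp(2·(k/2))`. [folklore] -/
theorem valuation_lamSeven_even (v : HeightOneSpectrum (𝓞 ℚ)) (hv : Rat.HeightOneSpectrum.natGenerator v = 7) {k : ℕ}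
    (hk : 1 ≤ k) (heven : Even k) :
    (∃ m : ℤ, v.valuation ℚ ((2 : ℚ)⁻¹ + 2 / 7 ^ k) = WithZero.exp (2 * m)) ∧
      ∃ m : ℤ, v.valuation ℚ ((2 : ℚ)⁻¹ + 2 / 7 ^ k - 1) = WithZero.exp (2 * m) := by
  obtain ⟨m, hm⟩ := heven
  have hkm : (k : ℤ) = 2 * (m : ℤ) := by rw [hm]; push_cast; ring
  exact ⟨⟨m, by rw [valuation_lamSeven v hv hk, hkm]⟩, ⟨m, by rw [valuation_lamSeven_sub_one v hv hk, hkm]⟩⟩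

/-- **For EVEN `k ≥ 1` the Legendre curve `y² = x(x−1)(x−λ_k)` is MULTIPLICATIVE at the place of `ℚ` over `7`** — over `ℚ` itself, no
twist: `|λ_k|_7 = exp(k) = |7^{−k/2}|_7² > 1` and this seat's `legendre_hasMultiplicativeReductionAt_of_one_lt_valuation_of_valuation_sq_eq`
(Silverman VII.5.4 (c), Case 3 with `d = 7^{−k/2} ∈ ℚ`). [cite: SilvermanAEC2009, proof of Prop. VII.5.4(c), Case 3 (PDF p. 177)]
[cite: Mochizuki2012, IUTchIV Prop 1.8 (vi) p.19] -/
theorem legendre_lamSeven_hasMultiplicativeReductionAt {k : ℕ} (hk : 1 ≤ k) (heven : Even k) (v : HeightOneSpectrum (𝓞 ℚ))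
    (hv : Rat.HeightOneSpectrum.natGenerator v = 7) :
    (⟨0, -(1 + ((2 : ℚ)⁻¹ + 2 / 7 ^ k)), 0, (2 : ℚ)⁻¹ + 2 / 7 ^ k, 0⟩ : WeierstrassCurve ℚ).HasMultiplicativeReductionAt v := by
  obtain ⟨m, hm⟩ := heven
  have h2 : v.valuation ℚ (2 : ℚ) = 1 := by exact_mod_cast valuation_natCast_eq_one v hv (n := 2) (by omega)
  haveI : (⟨0, -(1 + ((2 : ℚ)⁻¹ + 2 / 7 ^ k)), 0, (2 : ℚ)⁻¹ + 2 / 7 ^ k, 0⟩ : WeierstrassCurve ℚ).IsElliptic :=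
    (legendre_isElliptic_iff (by norm_num) _).mpr (Cor22.lamSeven_ne hk)
  have hla : 1 < v.valuation ℚ ((2 : ℚ)⁻¹ + 2 / 7 ^ k) := by
    rw [valuation_lamSeven v hv hk, ← WithZero.exp_zero]
    exact WithZero.exp_lt_exp.mpr (by exact_mod_cast hk)
  refine legendre_hasMultiplicativeReductionAt_of_one_lt_valuation_of_valuation_sq_eq v h2 hla (d := ((7 : ℚ) ^ m)⁻¹) ?_
  rw [map_inv₀, valuation_seven_pow v hv m, inv_inv, valuation_lamSeven v hv hk, ← WithZero.exp_nsmul]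
  congr 1
  rw [hm]; push_cast; ring

end LamSevenEven

/-! ## §2. The fibre form at the `K`-level pilot datum: `¬ 7 ∣ e ∧ e ∣ 15·l` for even `k` -/

/-- **THE k-PARITY LOCAL TYPE at `λ_k = 1/2 + 2/7^k`, `k` EVEN.** For `k ≥ 1` even, `l ≥ 11` (`l` prime by [IUTchI] Def. 3.1 (c), `T.D.l_prime`),
EVERY genuine Θ-volume datum `T` at `(ratPoint λ_k, l)` and EVERY fibre point `x₀ | 7` of the index of `pilotDataOfK T.D T.K`:
**`¬ 7 ∣ e(K_{x₀}/ℚ_7)` and `e(K_{x₀}/ℚ_7) ∣ 15·l`** — the completion is TAME over `ℚ_7` of ramification index a divisor of `15·l`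
(`e(x₀|v) ∣ l` in `K/F`; `e(v|7) ∣ 15` in `F/ℚ` since `E_{λ_k}` is multiplicative at `7` over `ℚ` and inertia fixes `√−1, √λ_k, √(λ_k−1)`:
this seat's `Cor22.ThetaVolumeDatumAt.ramificationIdx_int_dvd_fifteen_mul_ratPoint'`). Compare abc-iut-W-neg-1's `GenuineK.localType_lamSeven`
(`∣ 60·l`, every `k`) and `…_thirty` (`∣ 30·l`, every `k`). [cite: Mochizuki2012, IUTchI Ex. 3.2 (iv) p. 71; IUTchIV Thm. 1.10 Steps (ii)–(iii) p. 24–26, Cor. 2.2 (ii) proof (P5) p. 46]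
[cite: SilvermanATAEC1994, V.4–V.5 and Exercise 5.13 (b)] [claim: Mochizuki2012, status: disputed] -/
theorem GenuineK.localType_lamSeven_fifteen {k l : ℕ} (hk : 1 ≤ k) (heven : Even k) (h11 : 11 ≤ l)
    (T : Cor22.ThetaVolumeDatumAt (ratPoint ((2 : ℚ)⁻¹ + 2 / 7 ^ k)) l) :
    letI := T.instFieldF; letI := T.instNumberFieldF; letI := T.instAlgebraF; letI := T.instFieldK
    letI := T.instNumberFieldK; letI := T.instAlgebraK; letI := T.instFieldFbar; letI := T.instAlgebraFbar
    letI := T.instAlgebraKFbar; letI := T.instIsElliptic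
    haveI : Fact (Nat.Prime 7) := ⟨by norm_num⟩
    ∀ x₀ : (thetaIndex (pilotDataOfK T.D T.K)).Fibre (.inr ⟨7, by norm_num⟩),
      ¬ 7 ∣ absRamificationIdx 7 (kOf (pilotDataOfK T.D T.K) 7 x₀) ∧
      absRamificationIdx 7 (kOf (pilotDataOfK T.D T.K) 7 x₀) ∣ 15 * l := by
  -- adapted from abc-iut-W-neg-1's `GenuineK.absRamificationIdx_kOf_dvd_ratPoint` (Cor312GenuineKLocalType.lean)
  letI := T.instFieldF; letI := T.instNumberFieldF; letI := T.instAlgebraF; letI := T.instFieldK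
  letI := T.instNumberFieldK; letI := T.instAlgebraK; letI := T.instFieldFbar; letI := T.instAlgebraFbar
  letI := T.instAlgebraKFbar; letI := T.instIsElliptic
  haveI : Fact (Nat.Prime 7) := ⟨by norm_num⟩
  have hl : l.Prime := T.D.l_prime
  set X := pilotDataOfK T.D T.K with hXdef
  intro x₀
  set w := placeOf X 7 x₀ with hwdef
  have hpw : ((7 : ℕ) : 𝓞 T.K) ∈ w.asIdeal := natCast_mem_placeOf X 7 x₀
  have hwchar : residueChar T.K w = 7 := residueChar_eq_of_natCast_mem 7 hpw
  -- the norm-defined `e(K_{x₀}/ℚ_7)` is `e(w | 7)`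
  have hekOf : absRamificationIdx 7 (kOf X 7 x₀) = w.asIdeal.ramificationIdx ℤ := by
    rw [show absRamificationIdx 7 (kOf X 7 x₀) = absRamificationIdx 7 (RescaledCompletion T.K 7 (placeOf X 7 x₀) hpw) from rfl,
      absRamificationIdx_rescaledCompletion]
  have hnot : (7 : ℕ) ∉ ({2, 3, 5, l} : Finset ℕ) := by
    simp only [Finset.mem_insert, Finset.mem_singleton, not_or]
    exact ⟨by norm_num, by norm_num, by norm_num, by omega⟩
  have hdvd : w.asIdeal.ramificationIdx ℤ ∣ 15 * l :=
    T.ramificationIdx_int_dvd_fifteen_mul_ratPoint' hnot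
      (fun v hv => LamSevenEven.legendre_lamSeven_hasMultiplicativeReductionAt hk heven v hv)
      (fun v hv => (LamSevenEven.valuation_lamSeven_even v hv hk heven).1)
      (fun v hv => (LamSevenEven.valuation_lamSeven_even v hv hk heven).2) w hwchar
  rw [hekOf]
  refine ⟨fun h => ?_, hdvd⟩
  -- `7 ∤ 15·l` for a prime `l ≥ 11`
  have h' : 7 ∣ 15 * l := h.trans hdvd
  rcases (Nat.Prime.dvd_mul (by norm_num : Nat.Prime 7)).1 h' with h15 | hll
  · omega
  · exact absurd ((Nat.prime_dvd_prime_iff_eq (by norm_num) hl).1 hll) (by omega)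

/-- **Corollary: `e(K_{x₀}/ℚ_7) ≤ 15·l`** at every fibre point `x₀ | 7` of a genuine Θ-volume datum at `(ratPoint λ_k, l)` for EVEN `k ≥ 1`,
`l ≥ 11` — the hypothesis `hloc` of the refutation engines (`GenuineK.…_of_ramBound` p458036, `…_of_ramification_le` p458737,
`…_sharp` p462041) with `E := 15·l` (against `60·l` of p459442 and the exact Tate type `30·l` of p461700, both valid for every `k`).
[cite: Mochizuki2012, IUTchIV Prop. 1.2 p. 10] [claim: Mochizuki2012, status: disputed] -/
theorem GenuineK.absRamificationIdx_kOf_le_fifteen_mul_lamSeven {k l : ℕ} (hk : 1 ≤ k) (heven : Even k) (h11 : 11 ≤ l)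
    (T : Cor22.ThetaVolumeDatumAt (ratPoint ((2 : ℚ)⁻¹ + 2 / 7 ^ k)) l) :
    letI := T.instFieldF; letI := T.instNumberFieldF; letI := T.instAlgebraF; letI := T.instFieldK
    letI := T.instNumberFieldK; letI := T.instAlgebraK; letI := T.instFieldFbar; letI := T.instAlgebraFbar
    letI := T.instAlgebraKFbar; letI := T.instIsElliptic
    haveI : Fact (Nat.Prime 7) := ⟨by norm_num⟩
    ∀ x₀ : (thetaIndex (pilotDataOfK T.D T.K)).Fibre (.inr ⟨7, by norm_num⟩),
      absRamificationIdx 7 (kOf (pilotDataOfK T.D T.K) 7 x₀) ≤ 15 * l := by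
  intro x₀
  exact Nat.le_of_dvd (by omega) (GenuineK.localType_lamSeven_fifteen hk heven h11 T x₀).2

end Summit.ABC.IUTFork.Conditional

end
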